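import Summits.ABC.IUTFork.MLFGaloisTFG
import Literature.AnabelianGeometry.AbsoluteAnabelian.AbsTopIThm26UniversalClosuresRefuted
import HarnessLib

/-!
# [AbsTopI] Thm 2.6 (ii) at the point `X = Spec k` over an MLF — UNCONDITIONAL instance form
# (abc-iut FACT-LIST row F-0247 `FundamentalExtension.Thm26ii`)

Cell `abc-iut`, layer L4, DAG node AbsTopI:Thm2.6(ii).  S. Mochizuki, *Topics in Absolute Anabelian
Geometry I* (2012), Thm 2.6 (ii) p. 21 [cite: MochizukiAbsTopI2012, Thm 2.6 (ii) p.21].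

The Literature companion `AbsTopIThm26UniversalClosuresRefuted.lean` (abc-iut-f-090) refutes the
universal closure of the typed predicate `Thm26ii B Σ` and proves the instance form at the point
extensions `Π = G ≅ G_k`, `Δ = 1` (`MLFBase.thm26ii_of_geom_eq_bot`) GIVEN the one input of the
printed proof (p. 23 l. 11–13) that is not a Literature theorem: the topological finite generation
of `G_k` ([NSW] Thm 7.5.10; abc-iut GAP-LEDGER row G-L4t4-2).  That input is PROVED Summits-side
(`MLFGaloisTFG.lean`, abc-iut-L4-d1: `isTopologicallyFinitelyGenerated_absoluteGaloisGroup_padic`,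
over the tree's `localEulerPoincareCharacteristic_holds`), so the point instance is assembled HERE
without hypotheses:

* `FundamentalExtension.MLFBase.thm26ii_of_geom_eq_bot'` — for EVERY extension with MLF base data
  and `Δ = 1`, the typed Thm 2.6 (ii) holds for every `Σ`;
* `exists_geom_eq_bot_thm26ii` — the genuine point datum over any finite `k/ℚ_p`
  (`Π = G = Gal(k̄/k)`, identity augmentation) satisfies it.

Proof-only; no definitions.  HONEST FRAMING: a degenerate (`Δ = 1`) but arithmetically genuine
instance of a typed predicate; nothing here asserts anything about abc or takes a side on
[IUTchIII] Cor. 3.12; typed ≠ proved elsewhere.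
-/

noncomputable section

namespace Summit.ABC.IUTFork

open Field Literature.AnabelianGeometry.AbsoluteAnabelian

/-- **[AbsTopI] Thm 2.6 (ii) at the point over an MLF, UNCONDITIONAL**: for every extension
`1 → Δ → Π → G → 1` with MLF base data `G ≅ G_k` and `Δ = 1`, the typed predicate `E.Thm26ii B Σ`
holds for every `Σ` — `MLFBase.thm26ii_of_geom_eq_bot` with its input "`Π` topologically finitely
generated" discharged: `Π ≅ G` (a continuous bijection of compact Hausdorff groups) and `G ≅ G_k` is
topologically finitely generated (`isTopologicallyFinitelyGenerated_gal_of_mlfBase`, [NSW] 7.5.10).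
[cite: MochizukiAbsTopI2012, Thm 2.6 (ii) p.21] -/
theorem _root_.Literature.AnabelianGeometry.AbsoluteAnabelian.FundamentalExtension.MLFBase.thm26ii_of_geom_eq_bot'
    {E : FundamentalExtension.{0}} (B : E.MLFBase) (hΔ : E.geom = ⊥) (S : Set ℕ) :
    E.Thm26ii B S := by
  -- `aug : Π → G` is a continuous bijection of compact Hausdorff groups, hence `Π ≃ₜ* G`
  have hinj : Function.Injective E.aug := (MonoidHom.ker_eq_bot_iff E.aug.toMonoidHom).mp hΔ
  let e₀ : E.arith ≃ E.gal := Equiv.ofBijective E.aug ⟨hinj, E.aug_surjective⟩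
  let eₜ : E.arith ≃ₜ E.gal := Continuous.homeoOfEquivCompactToT2 (f := e₀) (map_continuous E.aug)
  let e : E.arith ≃ₜ* E.gal := ContinuousMulEquiv.mk' eₜ fun x y => map_mul E.aug x y
  exact B.thm26ii_of_geom_eq_bot hΔ
    ((FundamentalExtension.isTopologicallyFinitelyGenerated_gal_of_mlfBase B).of_continuousMulEquiv
      e.symm) S

/-- **The genuine point instance of [AbsTopI] Thm 2.6 (ii)**: for every finite extension `k/ℚ_p`,
the extension `Π = G = Gal(k̄/k)` (identity augmentation, `Δ = 1`; the datum of `X = Spec k`) with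
its tautological MLF base data satisfies the typed Thm 2.6 (ii) for every `Σ`, unconditionally.
[cite: MochizukiAbsTopI2012, Thm 2.6 (ii) p.21] -/
theorem exists_geom_eq_bot_thm26ii (p : ℕ) [Fact p.Prime] (K : Type) [Field K] [Algebra ℚ_[p] K]
    [FiniteDimensional ℚ_[p] K] :
    ∃ (E : FundamentalExtension.{0}) (B : E.MLFBase), B.p = p ∧
      Nonempty (E.arith ≃ₜ* absoluteGaloisGroup K) ∧ E.geom = ⊥ ∧ ∀ S : Set ℕ, E.Thm26ii B S := by
  haveI : CharZero K := charZero_of_injective_algebraMap (algebraMap ℚ_[p] K).injective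
  let E : FundamentalExtension.{0} :=
    { arith := absoluteGaloisGrp K
      gal := absoluteGaloisGrp K
      aug := ContinuousMonoidHom.id _
      aug_surjective := Function.surjective_id }
  let B : E.MLFBase := { p := p, K := K, galIso := ContinuousMulEquiv.refl _ }
  have hΔ : E.geom = ⊥ := (MonoidHom.ker_eq_bot_iff _).mpr Function.injective_id
  exact ⟨E, B, rfl, ⟨ContinuousMulEquiv.refl _⟩, hΔ, fun S => B.thm26ii_of_geom_eq_bot' hΔ S⟩

end Summit.ABC.IUTFork

end
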